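import Mathlib.MeasureTheory.Integral.Prod
import Mathlib.MeasureTheory.Function.AEEqOfIntegral
import Mathlib.MeasureTheory.Function.LocallyIntegrable
import Mathlib.MeasureTheory.Group.Integral
import Mathlib.MeasureTheory.Group.LIntegral
import Mathlib.Analysis.Calculus.ParametricIntegral
import Literature.NumberTheory.Automorphic.AutomorphicFormsL2Derivative
import Literature.NumberTheory.Automorphic.AutomorphicSpectrumProofs
import HarnessLib

/-!
# Weighted Bochner integrals of translates in `L²` of the automorphic quotient, evaluated pointwise

Topic `NumberTheory/Automorphic`; sibling of `AutomorphicFormsL2DerivativeIntegral`, whose §2 (Bochner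
integrals of translates along CURVES `ℝ → G(𝔸_K)` against a finite measure) is generalised here to WEIGHTED
integrals `∫ α(s) R(c(s)) [F] dρ(s)` over an arbitrary second-countable parameter space `S`, a continuous family
`c : S → G(𝔸_K)`, an s-finite measure `ρ` and a weight `α ∈ L¹(ρ)` — the shape of the integrated representation
`π(α) = ∫ α(u) π(u) du` of a locally compact group mapped into `G(𝔸_K)` ([Folland1995, §3.2];
[BorelJacquet1979, §4.6]).  Everything is PROVED; no definition, no instance, no `sorry`.

Setting: `𝒢` an adelic group datum over a number field `K`, `μ` an automorphic measure on the quotient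
`X = G(𝔸_K) ⧸ (A_G · G(K))` (`[𝒢.IsAutomorphicMeasure μ]`: finite, positive on opens, `G(𝔸_K)`-invariant; the
regular representation `R` on `L²(μ)`, `(R(g) f)(y) = f(g⁻¹ • y)` a.e., is strongly continuous,
`isStronglyContinuous_rightRegular_holds`).

* `measurable_param_smul`, `quasiMeasurePreserving_param_smul` — `(s, y) ↦ c(s) • y` is measurable and
  quasi-measure-preserving `ρ ⊗ μ → μ`;
* `integrable_mul_mul_comp_param_smul` — `(s, y) ↦ α(s) ψ(y) F(c(s) • y)` is `ρ ⊗ μ`-integrable for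
  `F, ψ ∈ ℒ²(μ)`, `α ∈ L¹(ρ)` (Hölder fibrewise + invariance of `μ`);
* **`coeFn_integral_smul_rightRegular_toLp`** — the `L²(μ)`-valued Bochner integral `∫ α(s) R(c(s)) [F] dρ(s)`
  has the representative `y ↦ ∫ α(s) F(c(s)⁻¹ • y) dρ(s)` (pairing with indicators, the a.e. formula for `R`,
  Fubini — the pattern of `coeFn_integral_rightRegular_toLp`);
* `stronglyMeasurable_integral_mul_comp_param_smul` — that representative is strongly measurable for `F`, `α`
  strongly measurable.

Consumed by `AutomorphicFormsL2OrbitalSmoothing` (`S = U` a locally compact group, `ρ` a Haar measure,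
`c = ι : U →* G(𝔸_K)`): the everywhere-defined orbital integral representing `R(α) [F]` and its regularity
along `ι`-orbits (cell hodgecm-mathlib, floor 0, programme P2, socket (D), road (h) step h3).

## References
* [BorelJacquet1979] A. Borel, H. Jacquet, *Automorphic forms and automorphic representations*, Proc. Sympos.
  Pure Math. 33.1 (1979), §4.6 (the regular representation on `L²(G(K)\G(𝔸))`).
* [Folland1995] G. B. Folland, *A Course in Abstract Harmonic Analysis* (1995), §3.1–3.2 (the integrated
  representation `π(f) = ∫ f(x) π(x) dx`, `f ∈ L¹(G)`).
* [HarishChandraTAMS1953] Harish-Chandra, Trans. AMS 75 (1953), §9 (vectors `∫ f(x) π(x) ψ dx`).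
-/

open scoped Topology InnerProductSpace ENNReal NNReal Pointwise
open NumberField Filter Set Function
open _root_.MeasureTheory _root_.MeasureTheory.Measure

noncomputable section

namespace Literature.NumberTheory.Automorphic

namespace AdelicGroupData

/-! ### 1. Weighted Bochner integrals of translates along a parametrised family -/

section Param

variable {K : Type} [Field K] [NumberField K] (𝒢 : AdelicGroupData K)
  (μ : Measure 𝒢.automorphicQuotient) [𝒢.IsAutomorphicMeasure μ]
  {S : Type*} [TopologicalSpace S] [MeasurableSpace S] [BorelSpace S] [SecondCountableTopology S]

/-- For a continuous family `c : S → G(𝔸_K)` on a second-countable parameter space, the map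
`(s, y) ↦ c(s) • y` is (Borel) measurable. [cite: Folland1995, §3.2] -/
theorem measurable_param_smul {c : S → 𝒢.Adelic} (hc : Continuous c) :
    Measurable fun p : S × 𝒢.automorphicQuotient ↦ c p.1 • p.2 :=
  ((hc.comp continuous_fst).smul continuous_snd).measurable

/-- For a continuous family `c : S → G(𝔸_K)` and an s-finite measure `ρ` on `S`, the map
`(s, y) ↦ c(s) • y` is quasi-measure-preserving from `ρ ⊗ μ` to the invariant measure `μ` (Tonelli:
every fibre `y ↦ c(s) • y` preserves `μ`). [cite: Folland1995, §3.2] -/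
theorem quasiMeasurePreserving_param_smul {c : S → 𝒢.Adelic} (hc : Continuous c)
    (ρ : Measure S) [SFinite ρ] :
    QuasiMeasurePreserving (fun p : S × 𝒢.automorphicQuotient ↦ c p.1 • p.2) (ρ.prod μ) μ := by
  have hT := 𝒢.measurable_param_smul hc
  refine ⟨hT, Measure.AbsolutelyContinuous.mk fun s hs hs0 ↦ ?_⟩
  rw [Measure.map_apply hT hs, Measure.prod_apply (hT hs)]
  have : ∀ r : S,
      μ (Prod.mk r ⁻¹' ((fun p : S × 𝒢.automorphicQuotient ↦ c p.1 • p.2) ⁻¹' s)) = μ s :=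
    fun r ↦ measure_preimage_smul μ (c r) s
  simp_rw [this, hs0, lintegral_zero]

/-- For `F, ψ ∈ ℒ²(μ)`, a continuous family `c : S → G(𝔸_K)`, an s-finite measure `ρ` on `S` and a
weight `α ∈ L¹(ρ)`, the function `(s, y) ↦ α(s) ψ(y) F(c(s) • y)` is integrable for `ρ ⊗ μ`: by Hölder and
the invariance of `μ` each fibre has `L¹`-norm at most `|α(s)| ‖ψ‖₂ ‖F‖₂`. [cite: Folland1995, §3.2] -/
theorem integrable_mul_mul_comp_param_smul {c : S → 𝒢.Adelic} (hc : Continuous c)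
    (ρ : Measure S) [SFinite ρ] {α : S → ℂ} (hα : Integrable α ρ)
    {F ψ : 𝒢.automorphicQuotient → ℂ} (hF : MemLp F 2 μ) (hψ : MemLp ψ 2 μ) :
    Integrable (fun p : S × 𝒢.automorphicQuotient ↦ α p.1 * (ψ p.2 * F (c p.1 • p.2))) (ρ.prod μ) := by
  have hFd : ∀ r, MemLp (fun x ↦ F (c r • x)) 2 μ := fun r ↦
    hF.comp_measurePreserving (measurePreserving_smul (c r) μ)
  have hnorm : ∀ r, eLpNorm (fun x ↦ F (c r • x)) 2 μ = eLpNorm F 2 μ := fun r ↦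
    eLpNorm_comp_measurePreserving hF.1 (measurePreserving_smul (c r) μ)
  have hprod : ∀ r, MemLp (fun x ↦ ψ x * F (c r • x)) 1 μ := fun r ↦ (hFd r).mul' hψ
  set M : ℝ := (eLpNorm ψ 2 μ * eLpNorm F 2 μ).toReal with hM
  have hMfin : eLpNorm ψ 2 μ * eLpNorm F 2 μ ≠ ⊤ := ENNReal.mul_ne_top hψ.2.ne hF.2.ne
  have hL1 : ∀ r, ∫ x, ‖ψ x * F (c r • x)‖ ∂μ ≤ M := by
    intro r
    rw [integral_norm_eq_lintegral_enorm (hprod r).1, ← eLpNorm_one_eq_lintegral_enorm, hM]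
    refine ENNReal.toReal_mono hMfin ?_
    calc eLpNorm (fun x ↦ ψ x * F (c r • x)) 1 μ
        ≤ (1 : ℝ≥0) * eLpNorm ψ 2 μ * eLpNorm (fun x ↦ F (c r • x)) 2 μ :=
          eLpNorm_le_eLpNorm_mul_eLpNorm'_of_norm hψ.1 (hFd r).1 (· * ·) 1
            (Eventually.of_forall fun x ↦ by simp)
      _ = eLpNorm ψ 2 μ * eLpNorm F 2 μ := by rw [hnorm r, ENNReal.coe_one, one_mul]
  have hm0 : AEStronglyMeasurable (fun p : S × 𝒢.automorphicQuotient ↦ ψ p.2 * F (c p.1 • p.2))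
      (ρ.prod μ) :=
    (hψ.1.comp_quasiMeasurePreserving quasiMeasurePreserving_snd).mul
      (hF.1.comp_quasiMeasurePreserving (𝒢.quasiMeasurePreserving_param_smul μ hc ρ))
  have hm : AEStronglyMeasurable
      (fun p : S × 𝒢.automorphicQuotient ↦ α p.1 * (ψ p.2 * F (c p.1 • p.2))) (ρ.prod μ) :=
    (hα.1.comp_quasiMeasurePreserving quasiMeasurePreserving_fst).mul hm0
  rw [integrable_prod_iff hm]
  constructor
  · exact Eventually.of_forall fun r ↦ (memLp_one_iff_integrable.1 (hprod r)).const_mul (α r)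
  · refine (hα.norm.mul_const M).mono' hm.norm.integral_prod_right' (Eventually.of_forall fun r ↦ ?_)
    rw [Real.norm_of_nonneg (integral_nonneg fun _ ↦ norm_nonneg _)]
    have : (fun x ↦ ‖α r * (ψ x * F (c r • x))‖) = fun x ↦ ‖α r‖ * ‖ψ x * F (c r • x)‖ := by
      funext x; rw [norm_mul]
    rw [this, integral_const_mul]
    exact mul_le_mul_of_nonneg_left (hL1 r) (norm_nonneg _)

/-- **The weighted `L²`-valued Bochner integral of translates, evaluated pointwise.** For a continuous
family `c : S → G(𝔸_K)`, an s-finite measure `ρ` on `S`, a weight `α ∈ L¹(ρ)` and `F ∈ ℒ²(μ)`, the Bochner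
integral `∫ α(s) R(c(s)) [F] dρ(s)` in `L²(μ)` of the continuous (strong continuity of `R`) orbit map has the
representative `y ↦ ∫ α(s) F(c(s)⁻¹ • y) dρ(s)`: both have the same integral over every measurable `A`
(pairing with the indicator of `A`, the a.e. formula `(R(g) [F])(y) = F(g⁻¹ • y)`, Fubini).  Generalises
`coeFn_integral_rightRegular_toLp` (curves, `α = 1`). Borel–Jacquet 1979, §4.6; Folland 1995, §3.1
(the integrated representation `π(α) = ∫ α(s) π(s) ds`). [cite: Folland1995, §3.2] [cite: BorelJacquetCorvallis1979, §4.6] -/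
theorem coeFn_integral_smul_rightRegular_toLp {c : S → 𝒢.Adelic} (hc : Continuous c)
    (ρ : Measure S) [SFinite ρ] {α : S → ℂ} (hα : Integrable α ρ)
    {F : 𝒢.automorphicQuotient → ℂ} (hF : MemLp F 2 μ) :
    ((∫ s, α s • 𝒢.rightRegular μ (c s) (hF.toLp F) ∂ρ : 𝒢.L2 μ) : 𝒢.automorphicQuotient → ℂ) =ᵐ[μ]
      fun y ↦ ∫ s, α s * F ((c s)⁻¹ • y) ∂ρ := by
  set γ : S → 𝒢.L2 μ := fun s ↦ 𝒢.rightRegular μ (c s) (hF.toLp F) with hγ_def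
  have hγc : Continuous γ := (𝒢.isStronglyContinuous_rightRegular_holds μ (hF.toLp F)).comp hc
  have hγi : Integrable (fun s ↦ α s • γ s) ρ := by
    refine (hα.norm.mul_const ‖hF.toLp F‖).mono' (hα.1.smul hγc.aestronglyMeasurable)
      (Eventually.of_forall fun s ↦ ?_)
    rw [norm_smul, hγ_def, 𝒢.norm_rightRegular_apply μ (c s)]
  have hd : Continuous fun s ↦ (c s)⁻¹ := hc.inv
  set T : 𝒢.L2 μ := ∫ s, α s • γ s ∂ρ with hT
  have hTi : Integrable (T : 𝒢.automorphicQuotient → ℂ) μ := (Lp.memLp T).integrable one_le_two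
  have hH : Integrable (fun p : S × 𝒢.automorphicQuotient ↦ α p.1 * F ((c p.1)⁻¹ • p.2)) (ρ.prod μ) := by
    have := 𝒢.integrable_mul_mul_comp_param_smul μ hd ρ hα hF (memLp_const 1)
    simpa only [one_mul] using this
  have hSi : Integrable (fun y ↦ ∫ s, α s * F ((c s)⁻¹ • y) ∂ρ) μ := hH.integral_prod_right
  refine hTi.ae_eq_of_forall_setIntegral_eq _ _ hSi fun A hA hμA ↦ ?_
  have hind : MemLp (A.indicator fun _ ↦ (1 : ℂ)) 2 μ :=
    memLp_indicator_const 2 hA 1 (Or.inr hμA.ne)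
  have hrep : ∀ s, (γ s : 𝒢.automorphicQuotient → ℂ) =ᵐ[μ] fun y ↦ F ((c s)⁻¹ • y) := fun s ↦
    (𝒢.rightRegular_apply_coeFn μ (c s) (hF.toLp F)).trans
      ((measurePreserving_smul (c s)⁻¹ μ).quasiMeasurePreserving.ae_eq_comp hF.coeFn_toLp)
  calc ∫ x in A, (T : 𝒢.automorphicQuotient → ℂ) x ∂μ
      = ⟪indicatorConstLp 2 hA hμA.ne (1 : ℂ), T⟫_ℂ :=
        (L2.inner_indicatorConstLp_one hA hμA.ne T).symm
    _ = ∫ s, ⟪indicatorConstLp 2 hA hμA.ne (1 : ℂ), α s • γ s⟫_ℂ ∂ρ := by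
        rw [hT, ← integral_inner hγi]
    _ = ∫ s, ∫ x, α s * (A.indicator (fun _ ↦ (1 : ℂ)) x * F ((c s)⁻¹ • x)) ∂μ ∂ρ := by
        congr 1 with s
        rw [inner_smul_right, L2.inner_indicatorConstLp_one, ← integral_indicator hA,
          ← integral_const_mul]
        refine integral_congr_ae ?_
        filter_upwards [hrep s] with x hx
        by_cases hxA : x ∈ A
        · simp only [indicator_of_mem hxA, one_mul, hx]
        · simp only [indicator_of_notMem hxA, zero_mul, mul_zero]
    _ = ∫ x, ∫ s, α s * (A.indicator (fun _ ↦ (1 : ℂ)) x * F ((c s)⁻¹ • x)) ∂ρ ∂μ :=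
        integral_integral_swap (𝒢.integrable_mul_mul_comp_param_smul μ hd ρ hα hF hind)
    _ = ∫ x, A.indicator (fun _ ↦ (1 : ℂ)) x * ∫ s, α s * F ((c s)⁻¹ • x) ∂ρ ∂μ := by
        congr 1 with x
        rw [← integral_const_mul]
        congr 1 with s
        ring
    _ = ∫ x in A, (∫ s, α s * F ((c s)⁻¹ • x) ∂ρ) ∂μ := by
        rw [← integral_indicator hA]
        congr 1 with x
        by_cases hxA : x ∈ A
        · simp only [indicator_of_mem hxA, one_mul]
        · simp only [indicator_of_notMem hxA, zero_mul]

/-- The pointwise representative `y ↦ ∫ α(s) F(c(s)⁻¹ • y) dρ(s)` of `coeFn_integral_smul_rightRegular_toLp` is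
strongly measurable when `F` is (the parametric integral of a jointly measurable integrand). [cite: Folland1995, §3.2] -/
theorem stronglyMeasurable_integral_mul_comp_param_smul {c : S → 𝒢.Adelic} (hc : Continuous c)
    (ρ : Measure S) [SFinite ρ] {α : S → ℂ} (hα : StronglyMeasurable α)
    {F : 𝒢.automorphicQuotient → ℂ} (hF : StronglyMeasurable F) :
    StronglyMeasurable fun y ↦ ∫ s, α s * F ((c s)⁻¹ • y) ∂ρ := by
  have hT := 𝒢.measurable_param_smul hc.inv
  have h1 : StronglyMeasurable
      (fun p : 𝒢.automorphicQuotient × S ↦ α p.2 * F ((c p.2)⁻¹ • p.1)) :=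
    (hα.comp_measurable measurable_snd).mul
      (hF.comp_measurable (hT.comp measurable_swap))
  exact h1.integral_prod_right

end Param

end AdelicGroupData

end Literature.NumberTheory.Automorphic
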